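import Mathlib
import Summits.Ventures.DiscreteObjects.Mahler.SmythAnalytic

/-!
# Smyth's theorem, isolation of `θ₀` — the case `ℓ < 2k` (venture `DiscreteObjects`, target L)

Cell `pub-namedobj`, seat `pub-namedobj-mahler` (gen 8). Framing: lottery ticket; floor = certified
bounds/negative ranges.

First piece of the isolation part of [McKee–Smyth, Thm 12.1] ("if `M(P) > θ₀` then
`M(P) > √((93+√2249)/80) = 1.32487…`"), following the successor blueprint
`HOME/pub-namedobj-mahler-g8/SMYTH-ISOLATION-PLAN.md` §1.  In the case `ℓ < 2k` of the proof
(§12.2.2), the Parseval family already gives (12.13) `40c⁴ - 93c² + 40 ≥ 0` for `c = 1/M(P)`, whence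
`c² ≤ (93 - √2249)/80 = 0.56970…`, i.e. `c ≤ 0.7548 < θ₀⁻¹ = 0.75487…`: in this case `M(P) ≥ 1.3248 > θ₀`
outright (no equality, and the gap).  We re-run the endgame of `SmythArith.smyth_caseA_arith` keeping the
sharp conclusion:

* `smyth_caseA_arith_sharp` — the real-arithmetic endgame with conclusion `c ≤ 7548/10000`;
* `SmythData.caseA_sharp`, `smyth_analytic_caseA_sharp` — the analytic statement: a Smyth pair with the
  nonreciprocity relations and `ℓ < 2k` has `c ≤ 0.7548` (so `M = 1/c ≥ 1.3248… > θ₀`).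

The case `ℓ ≥ 2k` (§12.2.4–12.2.6, Lemmas 12.17–12.19 and the integrality step (12.29)) is NOT done here.
-/

namespace Summit.Ventures.DiscreteObjects.Mahler

open Polynomial

/-- **§12.2.2 endgame, sharp form (12.13).**  Under the hypotheses of `smyth_caseA_arith`:
`c ≤ 0.7548` (from `40c⁴ - 93c² + 40 ≥ 0`, i.e. `c² ≤ (93 - √2249)/80`). -/
theorem smyth_caseA_arith_sharp {c x : ℝ} (hc : 3 / 4 ≤ c) (hc2 : c / 2 ≤ 1 - c ^ 2) (hx : |x| ≤ 1 - c ^ 2)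
    (h : ∀ β γ : ℝ, 5 * c ^ 2 / 4 + (x + γ * c) ^ 2 + (c / 2 + x / 2 - γ * c / 2 + β * c) ^ 2 ≤
      2 + γ ^ 2 + β ^ 2) : c ≤ 7548 / 10000 := by
  have hc78 : c ≤ 781 / 1000 := by nlinarith
  have h1c : 0 < 1 - c ^ 2 := by nlinarith
  obtain ⟨hxlo, hxhi⟩ := abs_le.mp hx
  set D2 : ℝ := 4 * c ^ 4 - 9 * c ^ 2 + 4 with hD2def
  set B : ℝ := 2 * c * (x * (3 - 4 * c ^ 2) - c) with hBdef
  set C0 : ℝ := 4 * (1 - c ^ 2) * (5 * c ^ 2 / 4 - 2) + 4 * (1 - c ^ 2) * x ^ 2 + (c + x) ^ 2 with hC0def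
  have hD2nn : 0 ≤ D2 := by
    have e : D2 = (2 * c ^ 2 + c - 2) * (2 * c ^ 2 - c - 2) := by rw [hD2def]; ring
    rw [e]
    apply mul_nonneg_of_nonpos_of_nonpos <;> nlinarith
  have hquad : ∀ γ : ℝ, (-D2) * γ ^ 2 + B * γ + C0 ≤ 0 := by
    intro γ
    set K : ℝ := (c + x - γ * c) / 2 with hK
    have hh := h (K * c / (1 - c ^ 2)) γ
    have iden : 4 * (1 - c ^ 2) * (5 * c ^ 2 / 4 + (x + γ * c) ^ 2 +
        (c / 2 + x / 2 - γ * c / 2 + K * c / (1 - c ^ 2) * c) ^ 2 - (2 + γ ^ 2 + (K * c / (1 - c ^ 2)) ^ 2))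
        = (-D2) * γ ^ 2 + B * γ + C0 := by
      rw [hD2def, hBdef, hC0def, hK]
      field_simp
      ring
    have : 4 * (1 - c ^ 2) * (5 * c ^ 2 / 4 + (x + γ * c) ^ 2 +
        (c / 2 + x / 2 - γ * c / 2 + K * c / (1 - c ^ 2) * c) ^ 2 - (2 + γ ^ 2 + (K * c / (1 - c ^ 2)) ^ 2))
        ≤ 0 := by
      apply mul_nonpos_of_nonneg_of_nonpos (by linarith) (by linarith)
    linarith
  obtain ⟨hdisc, hdeg⟩ := quad_forall_nonpos (by linarith) hquad
  have hΦ : B ^ 2 + 4 * D2 * C0 ≤ 0 := by linarith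
  by_cases hD : D2 = 0
  · -- degenerate case: `B = 0`, i.e. `x (3 - 4c²) = c`, impossible for `|x| ≤ 1 - c²`
    exfalso
    have hB : B = 0 := hdeg (by linarith)
    have hcx : x * (3 - 4 * c ^ 2) = c := by
      have : 2 * c * (x * (3 - 4 * c ^ 2) - c) = 0 := by rw [hBdef] at hB; exact hB
      have hc0 : (2 * c) ≠ 0 := by linarith
      have := (mul_eq_zero.mp this).resolve_left hc0
      linarith
    nlinarith
  · have hDpos : 0 < D2 := lt_of_le_of_ne hD2nn (Ne.symm hD)
    have hα : 0 < 16 * (1 - c ^ 2) * (5 - 8 * c ^ 2) := by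
      have : 0 < 5 - 8 * c ^ 2 := by nlinarith
      positivity
    have iden2 : 4 * (16 * (1 - c ^ 2) * (5 - 8 * c ^ 2)) * (B ^ 2 + 4 * D2 * C0) =
        (2 * (16 * (1 - c ^ 2) * (5 - 8 * c ^ 2)) * x + (64 * c ^ 5 - 96 * c ^ 3 + 32 * c)) ^ 2 -
          256 * (40 * c ^ 4 - 93 * c ^ 2 + 40) * D2 * (1 - c ^ 2) ^ 2 := by
      rw [hBdef, hC0def, hD2def]; ring
    have hL : 0 ≤ 40 * c ^ 4 - 93 * c ^ 2 + 40 := by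
      have h1 : 4 * (16 * (1 - c ^ 2) * (5 - 8 * c ^ 2)) * (B ^ 2 + 4 * D2 * C0) ≤ 0 :=
        mul_nonpos_of_nonneg_of_nonpos (by positivity) hΦ
      have h2 : 0 ≤ (2 * (16 * (1 - c ^ 2) * (5 - 8 * c ^ 2)) * x + (64 * c ^ 5 - 96 * c ^ 3 + 32 * c)) ^ 2 :=
        sq_nonneg _
      have h4 : 0 < 256 * D2 * (1 - c ^ 2) ^ 2 := by positivity
      by_contra hneg
      push Not at hneg
      have : 256 * (40 * c ^ 4 - 93 * c ^ 2 + 40) * D2 * (1 - c ^ 2) ^ 2 < 0 := by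
        have : 256 * (40 * c ^ 4 - 93 * c ^ 2 + 40) * D2 * (1 - c ^ 2) ^ 2 =
            (40 * c ^ 4 - 93 * c ^ 2 + 40) * (256 * D2 * (1 - c ^ 2) ^ 2) := by ring
        rw [this]; exact mul_neg_of_neg_of_pos hneg h4
      linarith
    -- from `40u² - 93u + 40 ≥ 0`, `u = c² ∈ [0.5625, 0.61]`: `u ≤ 0.7548²`
    have hu : c ^ 2 ≤ (7548 / 10000 : ℝ) ^ 2 := by
      by_contra hgt
      push Not at hgt
      have hu2 : c ^ 2 ≤ 62 / 100 := by nlinarith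
      -- the quadratic `40u² - 93u + 40` is negative on `[0.7548², 0.62]`
      nlinarith [mul_nonneg (sub_nonneg.mpr hgt.le) (sub_nonneg.mpr hu2)]
    nlinarith [hu]

namespace SmythData

variable {f g : ℂ → ℂ} {c : ℝ}

/-- **Case `ℓ < 2k` with `a = +1`, sharp form:** `c ≤ 0.7548`. -/
theorem caseA_sharp (D : SmythData f g c) {k ℓ : ℕ} (hkl : k < ℓ) (hl : ℓ < 2 * k) {b : ℤ}
    (hb : b = 1 ∨ b = -1) (hc : 3 / 4 ≤ c) (hc2 : c / 2 ≤ 1 - c ^ 2)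
    (hy : (jetCoeff f (ℓ - k)).re = (jetCoeff g (ℓ - k)).re)
    (hw : (jetCoeff f (2 * k - ℓ)).re = (jetCoeff g (2 * k - ℓ)).re)
    (hrelk : (jetCoeff f k).re = (jetCoeff g k).re + c)
    (hrell : (jetCoeff f ℓ).re = (jetCoeff g ℓ).re + (jetCoeff g (ℓ - k)).re + b * c) :
    c ≤ 7548 / 10000 := by
  have hPf := D.parsevalA_f hkl hl
  have hPg := D.parsevalA_g hkl hl
  have hyb : |(jetCoeff f (ℓ - k)).re| ≤ 1 - c ^ 2 := D.abs_re_le (n := ℓ - k) (by omega)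
  set y := (jetCoeff f (ℓ - k)).re with hy'
  set w := (jetCoeff f (2 * k - ℓ)).re with hw'
  set Fk := (jetCoeff f k).re with hFk
  set Fl := (jetCoeff f ℓ).re with hFl
  set Gk := (jetCoeff g k).re with hGk
  set Gl := (jetCoeff g ℓ).re with hGl
  rw [← hy] at hPg hrell
  rw [← hw] at hPg
  have hcomb : ∀ β γ : ℝ, 5 * c ^ 2 / 4 + (y + γ * c) ^ 2 +
      (b * c / 2 - y / 2 + γ * c / 2 + β * c) ^ 2 ≤ 2 + γ ^ 2 + β ^ 2 := by
    intro β γ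
    have h1 := hPf β γ
    have h2 := hPg β γ
    rw [hrelk, hrell] at h1
    nlinarith [h1, h2, sq_nonneg ((Gk + c + γ * w - c) + (Gk + γ * w + c)),
      sq_nonneg ((Gl + y + b * c + γ * (Gk + c) - y + β * c) + (Gl + γ * Gk + y - β * c))]
  rcases hb with hb1 | hb1
  · subst hb1
    refine smyth_caseA_arith_sharp hc hc2 (x := -y) (by rw [abs_neg]; exact hyb) (fun β' γ' => ?_)
    have := hcomb β' (-γ')
    push_cast at this
    nlinarith [this]
  · subst hb1
    refine smyth_caseA_arith_sharp hc hc2 (x := y) hyb (fun β' γ' => ?_)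
    have := hcomb (-β') γ'
    push_cast at this
    nlinarith [this]

end SmythData

/-- **Smyth's inequality, case `ℓ < 2k`, sharp form.**  A Smyth pair with the nonreciprocity relations
`fₙ = gₙ + a g_{n-k} [k ≤ n] + b c [n = ℓ]` for `n ≤ ℓ` (`1 ≤ k < ℓ < 2k`, integers `a, b ≠ 0`) has
`c ≤ 0.7548`, i.e. `M = 1/c ≥ 1.3248… > θ₀` ([McKee–Smyth (12.13)]): in this case the Mahler measure
is bounded away from `θ₀`. -/
theorem smyth_analytic_caseA_sharp {f g : ℂ → ℂ} {c : ℝ} (D : SmythData f g c) {k ℓ : ℕ} (hk : 1 ≤ k)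
    (hkl : k < ℓ) (hl2 : ℓ < 2 * k) {a b : ℤ} (ha : a ≠ 0) (hb : b ≠ 0)
    (hrel : ∀ n, n ≤ ℓ → (jetCoeff f n).re = (jetCoeff g n).re +
      (if k ≤ n then (a : ℝ) * (jetCoeff g (n - k)).re else 0) + (if n = ℓ then (b : ℝ) * c else 0)) :
    c ≤ 7548 / 10000 := by
  by_cases hc : c < 3 / 4
  · linarith
  push Not at hc
  have hrelk : (jetCoeff f k).re = (jetCoeff g k).re + a * c := by
    have h := hrel k hkl.le
    rw [if_pos le_rfl, if_neg (by omega), Nat.sub_self, D.symm.re_f0] at h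
    linarith
  obtain ⟨ha1, _, hc2⟩ := smyth_orderK hc (D.abs_re_le hk) (D.symm.abs_re_le hk) ha hrelk
  have hrell : (jetCoeff f ℓ).re = (jetCoeff g ℓ).re + a * (jetCoeff g (ℓ - k)).re + b * c := by
    have h := hrel ℓ le_rfl
    rw [if_pos hkl.le, if_pos rfl] at h
    exact h
  have hb1 : b = 1 ∨ b = -1 :=
    smyth_b_bound hc ha1 (D.abs_re_le (n := ℓ) (by omega)) (D.symm.abs_re_le (n := ℓ) (by omega))
      (D.symm.abs_re_le (n := ℓ - k) (by omega)) hb hrell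
  have hy : (jetCoeff f (ℓ - k)).re = (jetCoeff g (ℓ - k)).re := by
    have h := hrel (ℓ - k) (by omega)
    rw [if_neg (by omega), if_neg (by omega)] at h
    linarith
  have hw : (jetCoeff f (2 * k - ℓ)).re = (jetCoeff g (2 * k - ℓ)).re := by
    have h := hrel (2 * k - ℓ) (by omega)
    rw [if_neg (by omega), if_neg (by omega)] at h
    linarith
  rcases ha1 with h1 | h1
  · subst h1
    push_cast at hrelk hrell
    exact D.caseA_sharp hkl hl2 hb1 hc hc2 hy hw (by linarith) (by linarith)
  · subst h1
    push_cast at hrelk hrell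
    have hb1' : (-b) = 1 ∨ (-b) = -1 := by omega
    refine D.symm.caseA_sharp hkl hl2 hb1' hc hc2 hy.symm hw.symm (by linarith) ?_
    push_cast
    linarith

end Summit.Ventures.DiscreteObjects.Mahler
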